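import Summits.Langlands.Langlands.Statement
import Summits.Langlands.Langlands.Theorems.IrreducibilityBySelfDualityIrreducibleOffSectorTransfer
import Summits.Langlands.Langlands.Theorems.IrreducibilityBySelfDualityIrreducibleOffSectorFrameDevissage
import Summits.Langlands.Langlands.Theorems.IrreducibilityBySelfDualityIrreducibleOffSectorDeRhamBlocks
import Summits.Langlands.Langlands.Theorems.IrreducibilityBySelfDualityIrreducibleOffSectorConstituents
import Summits.Langlands.Langlands.Theorems.IrreducibilityBySelfDualityIrreducibleOffSectorIsobaricRigidity
import Literature.NumberTheory.Automorphic.IsAutomorphicAE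
import HarnessLib

/-!
# `IrreducibleOffSector` from reciprocity up to irreducibility — the isobaric bootstrap, STRUCTURAL
(crux stmt-Langlands-14329 `IrreducibilityBySelfDuality.IrreducibleOffSector`, line `Sketch`;
`--supports` file; imports `Summits.Langlands.Langlands.Statement` + landed stub modules + Literature
only, so that it can be used inside the route's deciding theorem `closes`)

**Theorem** (`isIrreducible_of_reciprocityUpToIrreducibility`).  Grant Arthur–Clozel (2.2) and (2.3)
for cuspidal Borel–Jacquet data (`JacquetShalika1981_partialPairL_boundary_repData` — the route's
input item `PairLBoundaryJS` verbatim — and `JacquetShalika1981_partialPairL_pole_repData`).  If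
reciprocity up to irreducibility holds over the number field `K` (ONE reciprocity datum `Rec` such
that for every `n ≥ 1`: (A') every L-algebraic cuspidal `π` of `GL_n(𝔸_K)` has for all `ℓ, ι` SOME
geometric `ρ` corresponding to it, and (B) `GaloisToAutomorphic n Rec hcpt` — the text of the route
item `ReciprocityUpToIrreducibility`, stmt-Langlands-14328, at `K`), then for every `n ≥ 1`, every
L-algebraic cuspidal `π` of `GL_n(𝔸_K)`, every `ℓ, ι` and EVERY `ρ : Γ_K → GL_n(ℚ̄_ℓ)` that is
Satake–Frobenius compatible with `(π, ι)` at almost all places, `ρ` is irreducible.  In particular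
the route item `IrreducibleOffSector` follows from `ReciprocityUpToIrreducibility` and the two
analytic facts (corollary `irreducibleOffSector_text_of_reciprocityUpToIrreducibility_text`, the
item's text verbatim, sector hypothesis unused), and the two open cruxes of the route collapse to
one.

**Proof** (Calegari–Gee 2013 §1.1: "if the Fontaine–Mazur–Langlands conjecture holds, then (by a
standard L-function argument) the reducibility of the Galois representation would show that the
automorphic representation could not be cuspidal"; Ramakrishnan 2008 §0).  The avatar `ρ₀` of (A')
is geometric; its Jordan–Hölder constituents are irreducible, geometric framed representations of
positive ranks whose Frobenius polynomials multiply to that of `ρ₀` (`stub_constituentsAssembly`, fed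
with the continuous dévissage `stub_frameDevissage` and Fontaine's Prop. 1.5.2
`stub_deRhamBlocks`); by (B) in lower rank each is attached to a cuspidal `σ_i` of `GL_{m_i}`; if there
were `k ≥ 2` of them the Satake family of `π` would be, a.e., the union of those of the `σ_i`
(L-normalised dictionary `arithFrobPolyOfSatake ι q 1` is multiplicative and injective), contradicting
isobaric rigidity (`isobaricRigidity_of_JS`, Jacquet–Shalika II Thm. 4.4).  So `ρ₀` is irreducible,
and irreducibility passes to every a.e.-compatible `ρ` by Chebotarev–Brauer–Nesbitt
(`isIrreducible_of_satakeFrobCompatible`).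

References: F. Calegari, T. Gee, *Irreducibility of automorphic Galois representations of GL(n), n at
most 5*, Ann. Inst. Fourier 63 (2013), §1.1; D. Ramakrishnan, *Irreducibility and cuspidality* (2008),
§0; H. Jacquet, J. Shalika, Amer. J. Math. 103 (1981) II, Thm. 4.4; P. Deligne, J.-P. Serre, ASENS 7
(1974), Lemme 3.2.
-/

noncomputable section

set_option linter.dupNamespace false

open scoped NumberField Classical Polynomial
open Filter IsDedekindDomain Polynomial
open Literature.NumberTheory.Automorphic Literature.NumberTheory.GaloisRepresentations
open Summit.Langlands

namespace Summit.Langlands.Langlands.Theorems.IrreducibleOffSector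

/-- `arithFrobPolyOfSatake ι q m (α + β) = (…α) * (…β)`: a direct sum of compatible Galois
representations corresponds to the union of Satake multisets. [folklore] -/
theorem arithFrobPolyOfSatake_add {ℓ : ℕ} [Fact ℓ.Prime] (ι : PadicAlgCl ℓ ≃+* ℂ) (q m : ℕ)
    (α β : Multiset ℂ) :
    arithFrobPolyOfSatake ι q m (α + β) =
      arithFrobPolyOfSatake ι q m α * arithFrobPolyOfSatake ι q m β := by
  simp [arithFrobPolyOfSatake, Multiset.map_add, Multiset.prod_add]

/-- `arithFrobPolyOfSatake` of a finite sum of multisets is the product. [folklore] -/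
theorem arithFrobPolyOfSatake_sum {ℓ : ℕ} [Fact ℓ.Prime] (ι : PadicAlgCl ℓ ≃+* ℂ) (q m : ℕ)
    {k : ℕ} (β : Fin k → Multiset ℂ) :
    arithFrobPolyOfSatake ι q m (∑ i, β i) = ∏ i, arithFrobPolyOfSatake ι q m (β i) := by
  classical
  induction k with
  | zero => simp [arithFrobPolyOfSatake]
  | succ k ih =>
    rw [Fin.sum_univ_castSucc, Fin.prod_univ_castSucc, arithFrobPolyOfSatake_add, ih]

/-- **The isobaric bootstrap** (Calegari–Gee 2013, §1.1; Ramakrishnan 2008, §0): granted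
Arthur–Clozel (2.2)–(2.3) for Borel–Jacquet data, reciprocity up to irreducibility over `K` — (A')
geometric avatars for L-algebraic cuspidal `π` in every rank and (B) `GaloisToAutomorphic` in every
rank, for ONE reciprocity datum — implies that EVERY `ρ : Γ_K → GL_n(ℚ̄_ℓ)` Satake–Frobenius
compatible almost everywhere with an L-algebraic cuspidal `π` of `GL_n(𝔸_K)` (`n ≥ 1`) is
irreducible. [cite: CalegariGee2013, §1.1] -/
theorem isIrreducible_of_reciprocityUpToIrreducibility
    (h22 : JacquetShalika1981_partialPairL_boundary_repData)
    (h23 : JacquetShalika1981_partialPairL_pole_repData)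
    {K : Type} [Field K] [NumberField K] {Rec : ReciprocityData K}
    (hRec : ∀ n : ℕ, 0 < n → ∀ hcpt : isCompact_glFiniteIntegralLevel n K,
      (∀ π : CuspidalAutomorphicRepData n K hcpt, π.1.IsLAlgebraic →
        ∀ (ℓ : ℕ) [Fact ℓ.Prime] (ι : PadicAlgCl ℓ ≃+* ℂ),
          ∃ ρ : FramedGaloisRep K (PadicAlgCl ℓ) n, IsGeometricFramed Rec ρ ∧ Corresponds Rec ι π.1 ρ) ∧
      GaloisToAutomorphic n Rec hcpt)
    {n : ℕ} (hcpt : isCompact_glFiniteIntegralLevel n K) (hn : 0 < n)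
    (π : CuspidalAutomorphicRepData n K hcpt) (hL : π.1.IsLAlgebraic) {ℓ : ℕ} [Fact ℓ.Prime]
    (ι : PadicAlgCl ℓ ≃+* ℂ) (ρ : FramedGaloisRep K (PadicAlgCl ℓ) n)
    (hρ : ∀ᶠ v : HeightOneSpectrum (𝓞 K) in cofinite, SatakeFrobCompatibleAt ι π.1 ρ v) :
    ρ.toGaloisRep.IsIrreducible := by
  -- the avatar of (A')
  obtain ⟨hA, -⟩ := hRec n hn hcpt
  obtain ⟨ρ₀, hgeo, hcorr₀⟩ := hA π hL ℓ ι
  suffices hirr₀ : ρ₀.toGaloisRep.IsIrreducible from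
    isIrreducible_of_satakeFrobCompatible π.1 ι hirr₀ hcorr₀.1 hρ
  -- its geometric constituents
  obtain ⟨k, m, r, hk, hr, hchar, hone⟩ :=
    stub_constituentsAssembly stub_frameDevissage stub_deRhamBlocks K ℓ n Rec ρ₀ hn hgeo
  by_cases hk1 : k = 1
  · exact hone hk1
  have hk2 : 2 ≤ k := by omega
  -- (B) in rank `m i` makes every constituent cuspidal automorphic
  have hσ : ∀ i, ∃ σ : CuspidalAutomorphicRepData (m i) K
      (isCompact_glFiniteIntegralLevel_holds (m i) K),
      ∀ᶠ v : HeightOneSpectrum (𝓞 K) in cofinite, SatakeFrobCompatibleAt ι σ.1 (r i) v := by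
    intro i
    obtain ⟨-, hB⟩ := hRec (m i) (hr i).1 (isCompact_glFiniteIntegralLevel_holds (m i) K)
    obtain ⟨σ, -, hcorr⟩ := hB ℓ ι (r i) (hr i).2.1 (hr i).2.2
    exact ⟨σ, hcorr.1⟩
  choose σ hσc using hσ
  -- isobaric rigidity forbids `k ≥ 2`
  refine (isobaricRigidity_of_JS h22 h23 K n hcpt hn π k m
    (fun i => isCompact_glFiniteIntegralLevel_holds (m i) K) σ hk2 (fun i => (hr i).1) ?_).elim
  have hall : ∀ᶠ v : HeightOneSpectrum (𝓞 K) in cofinite,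
      ∀ i, SatakeFrobCompatibleAt ι (σ i).1 (r i) v :=
    Filter.eventually_all.mpr hσc
  filter_upwards [hcorr₀.1, hall] with v hv hvi
  intro α hα
  obtain ⟨α₀, hα₀, -, hcp⟩ := hv
  obtain rfl : α = α₀ := AutomorphicRepData.hasSatakeParamAt_unique_holds π.1 hα hα₀
  choose β hβ _hurβ hcpβ using hvi
  refine ⟨β, hβ, ?_⟩
  -- the Frobenius polynomial of `ρ₀` is the product of those of the constituents
  have hprod : ρ₀.HasFrobCharpolyAt v (∏ i, arithFrobPolyOfSatake ι v.residueCard 1 (β i)) := by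
    intro 𝔓 h𝔓 τ hτ
    rw [hchar τ]
    exact Finset.prod_congr rfl fun i _ => hcpβ i 𝔓 h𝔓 τ hτ
  rw [← arithFrobPolyOfSatake_sum] at hprod
  have heq : arithFrobPolyOfSatake ι v.residueCard 1 α =
      arithFrobPolyOfSatake ι v.residueCard 1 (∑ i, β i) :=
    GaloisRep.HasFrobCharpolyAt.unique_holds
      ((FramedGaloisRep.hasFrobCharpolyAt_toGaloisRep_iff v _ ρ₀).mpr hcp)
      ((FramedGaloisRep.hasFrobCharpolyAt_toGaloisRep_iff v _ ρ₀).mpr hprod)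
  exact arithFrobPolyOfSatake_one_injective ι _ heq

/-- **The route item `IrreducibleOffSector` from the route item `ReciprocityUpToIrreducibility` and
Arthur–Clozel (2.2)–(2.3)** — both items' texts VERBATIM (structural form, for use inside the route's
deciding theorem): the sector hypothesis is not used. [cite: CalegariGee2013, §1.1] -/
theorem irreducibleOffSector_text_of_reciprocityUpToIrreducibility_text
    (h22 : JacquetShalika1981_partialPairL_boundary_repData)
    (h23 : JacquetShalika1981_partialPairL_pole_repData)
    (hE : ∀ (F : Type) [Field F] [NumberField F], ∃ Rec : ReciprocityData F, ∀ n : ℕ, 0 < n → ∀ hcpt : Literature.NumberTheory.Automorphic.isCompact_glFiniteIntegralLevel n F, (∀ π : Literature.NumberTheory.Automorphic.CuspidalAutomorphicRepData n F hcpt, π.1.IsLAlgebraic → ∀ (ℓ : ℕ) [Fact ℓ.Prime] (ι : PadicAlgCl ℓ ≃+* ℂ), ∃ ρ : Literature.NumberTheory.GaloisRepresentations.FramedGaloisRep F (PadicAlgCl ℓ) n, IsGeometricFramed Rec ρ ∧ Corresponds Rec ι π.1 ρ) ∧ GaloisToAutomorphic n Rec hcpt) :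
    ∀ (n : ℕ) (K : Type) [Field K] [NumberField K] (hcpt : Literature.NumberTheory.Automorphic.isCompact_glFiniteIntegralLevel n K), 0 < n → ∀ (π : Literature.NumberTheory.Automorphic.CuspidalAutomorphicRepData n K hcpt), π.1.IsLAlgebraic → ¬ (n = 3 ∧ NumberField.IsCMField K ∧ ∃ T : Literature.NumberTheory.Automorphic.InfinityType K n, π.1.HasInfinityType T ∧ T.IsRegular) → ∀ (ℓ : ℕ) [Fact ℓ.Prime] (ι : PadicAlgCl ℓ ≃+* ℂ) (ρ : Literature.NumberTheory.GaloisRepresentations.FramedGaloisRep K (PadicAlgCl ℓ) n), (∀ᶠ v : IsDedekindDomain.HeightOneSpectrum (NumberField.RingOfIntegers K) in cofinite, SatakeFrobCompatibleAt ι π.1 ρ v) → ρ.toGaloisRep.IsIrreducible := by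
  intro n K _ _ hcpt hn π hL _ ℓ _ ι ρ hρ
  obtain ⟨Rec, hRec⟩ := hE K
  exact isIrreducible_of_reciprocityUpToIrreducibility h22 h23 hRec hcpt hn π hL ι ρ hρ

end Summit.Langlands.Langlands.Theorems.IrreducibleOffSector

end
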